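import Summits.CriticalPhenomena.PercolationContinuityZ3.Theorems.Transplant.FKConnectivityAllQTwoClusterRayleighGraded
import Summits.CriticalPhenomena.PercolationContinuityZ3.Theorems.Transplant.FKConnectivityAllQForestAdjacentRayleighNd
import Summits.CriticalPhenomena.PercolationContinuityZ3.Theorems.Transplant.FKConnectivityAllQArborealLimit
import Summits.CriticalPhenomena.PercolationContinuityZ3.Theorems.Transplant.FKConnectivityAllQArborealContraction
import Summits.CriticalPhenomena.PercolationContinuityZ3.Theorems.Transplant.FKConnectivityAllQWheelAutomaton
import HarnessLib

/-!
# The FOREST SLICE of Conjecture R_q (kernel): `TwoClusterRayleighGradedOn V` at a fresh vertex `c` and the level `s₀ = 2|V| − 2|u₀| − |M| − 2`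
# IS the adjacent-pair forest Rayleigh inequality (♣) in guarded form — so R_q contains coefficientwise Rayleigh monotonicity of spanning
# forests at an adjacent pair

Support file (`--supports stmt-CriticalPhenomena-4575`), FK sub-lane `prim-bschramm-fk-1` (gen 16) of the post-continuity programme;
builds on p205010 (kernel theorem, internal audit signed; external expert review pending).  No definitions, no named facts, no sorries;
standard axioms.

THE ARROW (memo bschramm/FROM-fk-1-g16-FOREST-SLICE.md §1, now in the kernel).  Take the q-graded node `TwoClusterRayleighGradedOn V`
(`…TwoClusterRayleighGraded.lean`) at seeds `a = u = o`, `c = x` a vertex touched by NO pair of the fibre `(M, u₀)` and different from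
`o, v, y`, and at the level `s₀ = 2|V| − 2|u₀| − |M| − 2`.  Since `c` is isolated in every configuration of the fibre, inserting the pinned
pair `f' = cy` lowers the cluster count by one (`clusterCount_insert_isolated`) and `o ↮ c` after inserting `f'` means `o ↮ y` before
(`reachable_insert_isolated_iff`); with `|ω| + k(ω) = |V| + defi ω` and `defi = 0 ⟺ forest` (tree, `…ArborealLimit.lean`) the level
constraint `k₁ + k₂ = s₀` holds EXACTLY for pairs of forests.  Hence, with `e = ov`, `f = oy`, guard `G = {e, f ∉ ω}`, `Fo` = forests and
`𝒳 = xMinusEv o v y`: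
**`forestGuarded_of_gradedOn`**: `TwoClusterRayleighGradedOn V →` for every fibre `(M, u₀)` and all `o, v, y, c` with `c` fresh, `o ≠ v`,
`o ≠ y`, `v ≠ y`:  `#(G ∩ {ω ∪ {e,f} ∈ Fo}, G ∩ Fo) + #(G ∩ 𝒳, G ∩ 𝒳) ≤ #(G ∩ {ω ∪ {e} ∈ Fo}, G ∩ {ω ∪ {f} ∈ Fo})`
— the GUARDED fibre form of (♣) (the pinned pairs kept outside the configurations, as in Conjecture R); the three comparisons with the
node's graded counts are INCLUSIONS of fibre sets (`fibreCount_mono_fibre`), the level bookkeeping is `gradedCount_collapse`.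
So every refutation of (♣) on a graph with a spare vertex refutes R_q in the kernel, and R_q is at least as strong as coefficientwise
forest Rayleigh at adjacent pairs (Semple–Welsh Conj. 1.1's adjacent case, strong form).  The passage from the guarded form to the landed
node `AdjForestRayleighOn` (pinned pairs inside the configurations) is the bijection `ω ↦ ω ∖ {e}` on split fibres — left to a successor.
[cite: CibulkaHladkyLaCroixWagner2008, Thm. 1 (p. 2)] [cite: SempleWelsh2008, Conj. 1.1 (p. 2); Thm. 4.2 (p. 11)]
[cite: Grimmett2006, §1.2 eq. (1.1) (p. 4); §1.5 eq. (1.22) (p. 13)] [cite: Linusson2011, Prop. 2.6]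
-/

noncomputable section

namespace Summit.CriticalPhenomena.PercolationContinuityZ3.Theorems

namespace FK

open MeasureTheory Set Literature.Probability.LatticeModels Literature.Probability.Percolation
open scoped Classical symmDiff

variable {V : Type*} [Fintype V]

/-! ### Fibre-count bookkeeping -/

/-- Monotonicity of fibre counts under inclusion of the pair events on the fibre. [cite: Linusson2011, Prop. 2.6] -/
theorem fibreCount_mono_fibre (M u : BondConfig V) {A B A' B' : Set (BondConfig V)}
    (h : ∀ ω : BondConfig V, ω \ M = u → ω ∈ A → ω ∆ M ∈ B → ω ∈ A' ∧ ω ∆ M ∈ B') :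
    fibreCount M u A B ≤ fibreCount M u A' B' := by
  unfold fibreCount
  refine Finset.card_le_card fun ω hω => ?_
  rw [Finset.mem_filter] at hω ⊢
  exact ⟨hω.1, hω.2.1, h ω hω.2.1 hω.2.2.1 hω.2.2.2⟩

/-- **Level collapse**: if `A i = A' ∩ {κ₁ = i}` and `B j = B' ∩ {κ₂ = j}` with `κ₁, κ₂ ≤ |V|`, then the graded count at `s` is the single
fibre count of `A' ∩ {κ₁(ω) + κ₂(ω ∆ M) = s}` against `B'`. [cite: Linusson2011, Prop. 2.6] -/
theorem gradedCount_collapse (M u : BondConfig V) {A B : ℕ → Set (BondConfig V)} {A' B' : Set (BondConfig V)}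
    {κ₁ κ₂ : BondConfig V → ℕ} (hA : ∀ i ω, ω ∈ A i ↔ ω ∈ A' ∧ κ₁ ω = i) (hB : ∀ j ω, ω ∈ B j ↔ ω ∈ B' ∧ κ₂ ω = j)
    (h₁ : ∀ ω, κ₁ ω ≤ Fintype.card V) (h₂ : ∀ ω, κ₂ ω ≤ Fintype.card V) (s : ℕ) :
    gradedCount M u A B s = fibreCount M u (A' ∩ {ω | κ₁ ω + κ₂ (ω ∆ M) = s}) B' := by
  unfold gradedCount fibreCount
  symm
  refine (Finset.card_eq_sum_card_fiberwise (f := fun ω => (κ₁ ω, κ₂ (ω ∆ M)))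
    (t := Finset.range (Fintype.card V + 1) ×ˢ Finset.range (Fintype.card V + 1)) fun ω _ => ?_).trans ?_
  · simp only [Finset.coe_product, Finset.coe_range, Set.mem_prod, Set.mem_Iio]
    exact ⟨Nat.lt_succ_of_le (h₁ ω), Nat.lt_succ_of_le (h₂ _)⟩
  rw [Finset.sum_product]
  refine Finset.sum_congr rfl fun i _ => Finset.sum_congr rfl fun j _ => ?_
  by_cases hij : i + j = s
  · rw [if_pos hij]
    congr 1
    ext ω
    simp only [Finset.mem_filter, Finset.mem_univ, true_and, mem_inter_iff, mem_setOf_eq, Prod.mk.injEq, hA, hB]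
    constructor
    · rintro ⟨⟨hu, ⟨hA1, _⟩, hB1⟩, hi, hj⟩
      exact ⟨hu, ⟨hA1, hi⟩, hB1, hj⟩
    · rintro ⟨hu, ⟨hA1, hi⟩, hB1, hj⟩
      exact ⟨⟨hu, ⟨hA1, by rw [hi, hj, hij]⟩, hB1⟩, hi, hj⟩
  · rw [if_neg hij, Finset.card_eq_zero, Finset.eq_empty_iff_forall_notMem]
    intro ω hω
    simp only [Finset.mem_filter, Finset.mem_univ, true_and, mem_inter_iff, mem_setOf_eq, Prod.mk.injEq] at hω
    obtain ⟨⟨_, ⟨_, hs⟩, _⟩, hi, hj⟩ := hω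
    apply hij
    rw [← hi, ← hj]
    exact hs

/-! ### Configurations avoiding a vertex `c`: inserting the pendant pair `cy` -/

omit [Fintype V] in
/-- A configuration on the fibre `(M, u₀)` uses only pairs of `M ∪ u₀`. [folklore] -/
theorem mem_union_of_fibre {M u₀ ω : BondConfig V} (hω : ω \ M = u₀) {g : Sym2 V} (hg : g ∈ ω) : g ∈ M ∨ g ∈ u₀ := by
  by_cases hgM : g ∈ M
  · exact Or.inl hgM
  · right; rw [← hω]; exact ⟨hg, hgM⟩

omit [Fintype V] in
/-- The flip of a fibre configuration uses only pairs of `M ∪ u₀`. [folklore] -/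
theorem mem_union_of_fibre_symmDiff {M u₀ ω : BondConfig V} (hω : ω \ M = u₀) {g : Sym2 V} (hg : g ∈ ω ∆ M) : g ∈ M ∨ g ∈ u₀ := by
  rw [Set.mem_symmDiff] at hg
  rcases hg with ⟨hgω, _⟩ | ⟨hgM, _⟩
  · exact mem_union_of_fibre hω hgω
  · exact Or.inl hgM

omit [Fintype V] in
/-- **`o ↮ c` after inserting the pendant pair `cy` means `o ↮ y` before** (`c` isolated, `c ≠ o`). [folklore] -/
theorem reachable_insert_isolated_iff {X : BondConfig V} {c y o : V} (hc : ∀ g ∈ X, c ∉ g) (hco : c ≠ o) :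
    (openGraph (insert s(c, y) X)).Reachable o c ↔ (openGraph X).Reachable o y := by
  rw [KNSep.reachable_insert_iff]
  have h1 : ¬ (openGraph X).Reachable o c := not_reachable_of_isolated' hc hco.symm
  constructor
  · rintro (h | ⟨h, -⟩ | ⟨h, -⟩)
    · exact absurd h h1
    · exact absurd h h1
    · exact h
  · exact fun h => Or.inr (Or.inr ⟨h, SimpleGraph.Reachable.refl _⟩)

/-- **Inserting a pendant pair at an isolated vertex lowers the cluster count by one.** [cite: Grimmett2006, §1.2 eq. (1.1) (p. 4)] -/
theorem clusterCount_insert_isolated {X : BondConfig V} {c y : V} (hc : ∀ g ∈ X, c ∉ g) (hcy : c ≠ y) :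
    clusterCount (insert s(c, y) X) ∅ + 1 = clusterCount X ∅ := by
  have h := Wheel.clusterCount_insert_of_not_reachable X.toFinset (a := c) (b := y)
    (by rw [Set.coe_toFinset]; exact not_reachable_of_isolated hc hcy.symm)
  rwa [Finset.coe_insert, Set.coe_toFinset] at h

/-- A nonempty vertex type carries at least one cluster. [cite: Grimmett2006, §1.2 eq. (1.1) (p. 4)] -/
theorem one_le_clusterCount (o : V) (X : BondConfig V) : 1 ≤ clusterCount X ∅ := by
  unfold clusterCount
  haveI : Nonempty (openGraph X ⊔ wired (∅ : Set V)).ConnectedComponent := ⟨(openGraph X ⊔ wired ∅).connectedComponentMk o⟩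
  exact Nat.card_pos

/-! ### Sizes on a fibre -/

omit [Fintype V] in
/-- **`|ω| + |ω ∆ M| = 2|u₀| + |M|` on the fibre `(M, u₀)`.** [cite: Linusson2011, Prop. 2.6] -/
theorem ncard_add_ncard_symmDiff [Finite V] {M u₀ ω : BondConfig V} (hd : Disjoint u₀ M) (hω : ω \ M = u₀) :
    ω.ncard + (ω ∆ M).ncard = 2 * u₀.ncard + M.ncard := by
  have h1 : ω = u₀ ∪ (ω ∩ M) := by rw [← hω, Set.sdiff_union_inter]
  have h2 : ω ∆ M = u₀ ∪ (M \ ω) := by rw [Set.symmDiff_def, hω]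
  have hd1 : Disjoint u₀ (ω ∩ M) := hd.mono_right inter_subset_right
  have hd2 : Disjoint u₀ (M \ ω) := hd.mono_right Set.sdiff_subset
  have e1 : ω.ncard = u₀.ncard + (ω ∩ M).ncard := by
    conv_lhs => rw [h1]
    exact Set.ncard_union_eq hd1 (Set.toFinite _) (Set.toFinite _)
  have e2 : (ω ∆ M).ncard = u₀.ncard + (M \ ω).ncard := by
    rw [h2]; exact Set.ncard_union_eq hd2 (Set.toFinite _) (Set.toFinite _)
  have e3 : (M ∩ ω).ncard + (M \ ω).ncard = M.ncard := Set.ncard_inter_add_ncard_sdiff_eq_ncard M ω (Set.toFinite _)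
  rw [inter_comm] at e3
  omega

/-- **Forests are the configurations with `|ω| + k(ω) = |V|`** (deficiency zero). [cite: Grimmett2006, §1.5 (p. 13)] -/
theorem isForestCfg_iff_ncard_add (ω : BondConfig V) : IsForestCfg ω ↔ ω.ncard + clusterCount ω ∅ = Fintype.card V := by
  rw [← defi_eq_zero_iff, ncard_add_clusterCount_eq]; omega

/-! ### The forest slice of the graded node -/

/-- **The forest slice of Conjecture R_q (guarded form of (♣))**: see the file header. [cite: CibulkaHladkyLaCroixWagner2008, Thm. 1 (p. 2)]
[cite: SempleWelsh2008, Conj. 1.1 (p. 2)] [cite: Grimmett2006, §1.5 eq. (1.22) (p. 13)] [cite: Linusson2011, Prop. 2.6] -/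
theorem forestGuarded_of_gradedOn (h : TwoClusterRayleighGradedOn V) {M u₀ : BondConfig V} (hd : Disjoint u₀ M) {o v y c : V}
    (hcM : ∀ g ∈ M, c ∉ g) (hcu : ∀ g ∈ u₀, c ∉ g) (hco : c ≠ o) (hcv : c ≠ v) (hcy : c ≠ y) (hov : o ≠ v) (hoy : o ≠ y) (hvy : v ≠ y) :
    fibreCount M u₀ ({ω | s(o, v) ∉ ω ∧ s(o, y) ∉ ω} ∩ {ω | insert s(o, y) (insert s(o, v) ω) ∈ forestEv V})
        ({ω | s(o, v) ∉ ω ∧ s(o, y) ∉ ω} ∩ forestEv V) +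
      fibreCount M u₀ ({ω | s(o, v) ∉ ω ∧ s(o, y) ∉ ω} ∩ xMinusEv o v y) ({ω | s(o, v) ∉ ω ∧ s(o, y) ∉ ω} ∩ xMinusEv o v y) ≤
      fibreCount M u₀ ({ω | s(o, v) ∉ ω ∧ s(o, y) ∉ ω} ∩ {ω | insert s(o, v) ω ∈ forestEv V})
        ({ω | s(o, v) ∉ ω ∧ s(o, y) ∉ ω} ∩ {ω | insert s(o, y) ω ∈ forestEv V}) := by
  set N := Fintype.card V with hN
  have hef : s(o, v) ≠ s(o, y) := fun h' => hvy (Sym2.congr_right.1 h')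
  -- isolation of `c` on the fibre
  have iso : ∀ {ω : BondConfig V}, ω \ M = u₀ → ∀ g ∈ ω, c ∉ g := fun hω g hg =>
    (mem_union_of_fibre hω hg).elim (hcM g) (hcu g)
  have isoM : ∀ {ω : BondConfig V}, ω \ M = u₀ → ∀ g ∈ ω ∆ M, c ∉ g := fun hω g hg =>
    (mem_union_of_fibre_symmDiff hω hg).elim (hcM g) (hcu g)
  have hce : c ∉ s(o, v) := by rw [Sym2.mem_iff]; rintro (rfl | rfl) <;> [exact hco rfl; exact hcv rfl]
  have isoE : ∀ {ω : BondConfig V}, ω \ M = u₀ → ∀ g ∈ insert s(o, v) ω, c ∉ g := by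
    intro ω hω g hg
    rcases mem_insert_iff.1 hg with rfl | hg
    · exact hce
    · exact iso hω g hg
  have hcf' : c ∈ s(c, y) := Sym2.mem_mk_left c y
  -- degenerate fibres: a pinned pair inside the fibre kills the guard on one side
  by_cases htouch : s(o, v) ∈ M ∨ s(o, v) ∈ u₀ ∨ s(o, y) ∈ M ∨ s(o, y) ∈ u₀
  · have hz : ∀ (A B : Set (BondConfig V)),
        fibreCount M u₀ ({ω | s(o, v) ∉ ω ∧ s(o, y) ∉ ω} ∩ A) ({ω | s(o, v) ∉ ω ∧ s(o, y) ∉ ω} ∩ B) = 0 := by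
      intro A B
      refine fibreCount_eq_zero_of_forall _ _ _ _ fun ω hω h1 h2 => ?_
      have hsub : u₀ ⊆ ω := by rw [← hω]; exact Set.sdiff_subset
      have key : ∀ g : Sym2 V, g ∈ M ∨ g ∈ u₀ → g ∉ ω → g ∉ ω ∆ M → False := by
        intro g hg hgω hgωM
        rcases hg with hgM | hgu
        · exact hgωM (Set.mem_symmDiff.2 (Or.inr ⟨hgM, hgω⟩))
        · exact hgω (hsub hgu)
      rcases htouch with h' | h' | h' | h'
      · exact key _ (Or.inl h') h1.1.1 h2.1.1
      · exact key _ (Or.inr h') h1.1.1 h2.1.1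
      · exact key _ (Or.inl h') h1.1.2 h2.1.2
      · exact key _ (Or.inr h') h1.1.2 h2.1.2
    rw [hz, hz]
    exact Nat.zero_le _
  simp only [not_or] at htouch
  obtain ⟨heM, heu, hfM, hfu⟩ := htouch
  have hfω : ∀ {ω : BondConfig V}, ω \ M = u₀ → s(o, y) ∉ ω := fun hω hf =>
    (mem_union_of_fibre hω hf).elim hfM hfu
  have hfωM : ∀ {ω : BondConfig V}, ω \ M = u₀ → s(o, y) ∉ ω ∆ M := fun hω hf =>
    (mem_union_of_fibre_symmDiff hω hf).elim hfM hfu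
  -- the graded node at the fresh vertex and the forest level
  set s₀ : ℕ := 2 * N - (2 * u₀.ncard + M.ncard) - 2 with hs₀
  have I := h M u₀ hd o c o v c y s₀ (SimpleGraph.Reachable.refl _) (SimpleGraph.Reachable.refl _)
  -- collapse the three graded counts to single fibre counts with a level constraint
  rw [gradedCount_collapse M u₀ (A' := {ω | s(o, v) ∉ ω ∧ s(c, y) ∉ ω} ∩ {ω | insert s(c, y) (insert s(o, v) ω) ∈ sepEv o c})
      (B' := {ω | s(o, v) ∉ ω ∧ s(c, y) ∉ ω} ∩ sepEv o c) (κ₁ := fun ω => clusterCount (insert s(c, y) (insert s(o, v) ω)) ∅)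
      (κ₂ := fun ω => clusterCount ω ∅)
      (fun i ω => by simp only [mem_inter_iff, mem_setOf_eq, mem_levelSet_iff, and_assoc])
      (fun j ω => by simp only [mem_inter_iff, mem_setOf_eq, mem_levelSet_iff, and_assoc])
      (fun ω => clusterCount_empty_le_card _) (fun ω => clusterCount_empty_le_card _),
    gradedCount_collapse M u₀ (A' := {ω | s(o, v) ∉ ω ∧ s(c, y) ∉ ω} ∩ threeArmEv o c v y)
      (B' := {ω | s(o, v) ∉ ω ∧ s(c, y) ∉ ω} ∩ threeArmEv o c v y) (κ₁ := fun ω => clusterCount ω ∅) (κ₂ := fun ω => clusterCount ω ∅)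
      (fun i ω => by simp only [mem_inter_iff, mem_setOf_eq, mem_levelSet_iff, and_assoc])
      (fun j ω => by simp only [mem_inter_iff, mem_setOf_eq, mem_levelSet_iff, and_assoc])
      (fun ω => clusterCount_empty_le_card _) (fun ω => clusterCount_empty_le_card _),
    gradedCount_collapse M u₀ (A' := {ω | s(o, v) ∉ ω ∧ s(c, y) ∉ ω} ∩ {ω | insert s(o, v) ω ∈ sepEv o c})
      (B' := {ω | s(o, v) ∉ ω ∧ s(c, y) ∉ ω} ∩ {ω | insert s(c, y) ω ∈ sepEv o c}) (κ₁ := fun ω => clusterCount (insert s(o, v) ω) ∅)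
      (κ₂ := fun ω => clusterCount (insert s(c, y) ω) ∅)
      (fun i ω => by simp only [mem_inter_iff, mem_setOf_eq, mem_levelSet_iff, and_assoc])
      (fun j ω => by simp only [mem_inter_iff, mem_setOf_eq, mem_levelSet_iff, and_assoc])
      (fun ω => clusterCount_empty_le_card _) (fun ω => clusterCount_empty_le_card _)] at I
  -- (1) bad(♣) ⊆ bad(R_q) at the forest level
  have hbad : fibreCount M u₀ ({ω | s(o, v) ∉ ω ∧ s(o, y) ∉ ω} ∩ {ω | insert s(o, y) (insert s(o, v) ω) ∈ forestEv V})
        ({ω | s(o, v) ∉ ω ∧ s(o, y) ∉ ω} ∩ forestEv V) ≤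
      fibreCount M u₀ (({ω | s(o, v) ∉ ω ∧ s(c, y) ∉ ω} ∩ {ω | insert s(c, y) (insert s(o, v) ω) ∈ sepEv o c}) ∩
          {ω | clusterCount (insert s(c, y) (insert s(o, v) ω)) ∅ + clusterCount (ω ∆ M) ∅ = s₀})
        ({ω | s(o, v) ∉ ω ∧ s(c, y) ∉ ω} ∩ sepEv o c) := by
    refine fibreCount_mono_fibre M u₀ fun ω hω h1 h2 => ?_
    obtain ⟨⟨heω, -⟩, hF⟩ := h1
    obtain ⟨⟨heωM, -⟩, hF2⟩ := h2
    have hF' : IsForestCfg (insert s(o, y) (insert s(o, v) ω)) := hF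
    have hF2' : IsForestCfg (ω ∆ M) := hF2
    have hfX : s(o, y) ∉ insert s(o, v) ω := by
      rw [mem_insert_iff, not_or]; exact ⟨hef.symm, hfω hω⟩
    obtain ⟨hX, hoy'⟩ := (isForestCfg_insert_iff hoy hfX).1 hF'
    -- levels
    have k1 := clusterCount_insert_isolated (isoE hω) hcy
    have n1 := (isForestCfg_iff_ncard_add _).1 hX
    have n2 := (isForestCfg_iff_ncard_add _).1 hF2'
    have nins : (insert s(o, v) ω).ncard = ω.ncard + 1 := Set.ncard_insert_of_notMem heω (Set.toFinite _)
    have nT := ncard_add_ncard_symmDiff hd hω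
    refine ⟨⟨⟨⟨heω, fun hf' => iso hω _ hf' hcf'⟩, ?_⟩, ?_⟩, ⟨heωM, fun hf' => isoM hω _ hf' hcf'⟩, ?_⟩
    · show ¬ (openGraph (insert s(c, y) (insert s(o, v) ω))).Reachable o c
      rw [reachable_insert_isolated_iff (isoE hω) hco]; exact hoy'
    · show clusterCount (insert s(c, y) (insert s(o, v) ω)) ∅ + clusterCount (ω ∆ M) ∅ = s₀
      rw [hs₀, hN]; omega
    · exact not_reachable_of_isolated' (isoM hω) hco.symm
  -- (2) good(R_q) at the forest level ⊆ good(♣)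
  have hgood : fibreCount M u₀ (({ω | s(o, v) ∉ ω ∧ s(c, y) ∉ ω} ∩ {ω | insert s(o, v) ω ∈ sepEv o c}) ∩
          {ω | clusterCount (insert s(o, v) ω) ∅ + clusterCount (insert s(c, y) (ω ∆ M)) ∅ = s₀})
        ({ω | s(o, v) ∉ ω ∧ s(c, y) ∉ ω} ∩ {ω | insert s(c, y) ω ∈ sepEv o c}) ≤
      fibreCount M u₀ ({ω | s(o, v) ∉ ω ∧ s(o, y) ∉ ω} ∩ {ω | insert s(o, v) ω ∈ forestEv V})
        ({ω | s(o, v) ∉ ω ∧ s(o, y) ∉ ω} ∩ {ω | insert s(o, y) ω ∈ forestEv V}) := by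
    refine fibreCount_mono_fibre M u₀ fun ω hω h1 h2 => ?_
    obtain ⟨⟨⟨heω, -⟩, -⟩, hlev⟩ := h1
    obtain ⟨⟨heωM, -⟩, hsep⟩ := h2
    have hlev' : clusterCount (insert s(o, v) ω) ∅ + clusterCount (insert s(c, y) (ω ∆ M)) ∅ = s₀ := hlev
    have hsep' : ¬ (openGraph (insert s(c, y) (ω ∆ M))).Reachable o c := hsep
    rw [reachable_insert_isolated_iff (isoM hω) hco] at hsep'
    have k2 := clusterCount_insert_isolated (isoM hω) hcy
    have d1 := ncard_add_clusterCount_eq (insert s(o, v) ω)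
    have d2 := ncard_add_clusterCount_eq (ω ∆ M)
    have nins : (insert s(o, v) ω).ncard = ω.ncard + 1 := Set.ncard_insert_of_notMem heω (Set.toFinite _)
    have nT := ncard_add_ncard_symmDiff hd hω
    have k1pos := one_le_clusterCount o (insert s(o, v) ω)
    have hdefi : defi (insert s(o, v) ω) = 0 ∧ defi (ω ∆ M) = 0 := by
      rw [hs₀, hN] at hlev'; constructor <;> omega
    have hX : IsForestCfg (insert s(o, v) ω) := (defi_eq_zero_iff _).1 hdefi.1
    have hY : IsForestCfg (ω ∆ M) := (defi_eq_zero_iff _).1 hdefi.2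
    refine ⟨⟨⟨heω, hfω hω⟩, hX⟩, ⟨heωM, hfωM hω⟩, ?_⟩
    show IsForestCfg (insert s(o, y) (ω ∆ M))
    exact (isForestCfg_insert_iff hoy (hfωM hω)).2 ⟨hY, hsep'⟩
  -- (3) sq(♣) ⊆ sq(R_q) two levels up
  have hsq : fibreCount M u₀ ({ω | s(o, v) ∉ ω ∧ s(o, y) ∉ ω} ∩ xMinusEv o v y) ({ω | s(o, v) ∉ ω ∧ s(o, y) ∉ ω} ∩ xMinusEv o v y) ≤
      fibreCount M u₀ (({ω | s(o, v) ∉ ω ∧ s(c, y) ∉ ω} ∩ threeArmEv o c v y) ∩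
          {ω | clusterCount ω ∅ + clusterCount (ω ∆ M) ∅ = s₀ + 2})
        ({ω | s(o, v) ∉ ω ∧ s(c, y) ∉ ω} ∩ threeArmEv o c v y) := by
    refine fibreCount_mono_fibre M u₀ fun ω hω h1 h2 => ?_
    obtain ⟨⟨heω, -⟩, hF, hov1, -, hvy1⟩ := h1
    obtain ⟨⟨heωM, -⟩, hF2, hov2, -, hvy2⟩ := h2
    have n1 := (isForestCfg_iff_ncard_add _).1 hF
    have n2 := (isForestCfg_iff_ncard_add _).1 hF2
    have nT := ncard_add_ncard_symmDiff hd hω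
    have k1pos := one_le_clusterCount o ω
    have k2pos := one_le_clusterCount o (ω ∆ M)
    refine ⟨⟨⟨⟨heω, fun hf' => iso hω _ hf' hcf'⟩, ?_, hov1, ?_, hvy1⟩, ?_⟩,
      ⟨heωM, fun hf' => isoM hω _ hf' hcf'⟩, ?_, hov2, ?_, hvy2⟩
    · exact not_reachable_of_isolated' (iso hω) hco.symm
    · exact not_reachable_of_isolated (iso hω) hcv.symm
    · show clusterCount ω ∅ + clusterCount (ω ∆ M) ∅ = s₀ + 2
      rw [hs₀, hN]; omega
    · exact not_reachable_of_isolated' (isoM hω) hco.symm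
    · exact not_reachable_of_isolated (isoM hω) hcv.symm
  omega

end FK

end Summit.CriticalPhenomena.PercolationContinuityZ3.Theorems

end
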